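import Literature.AnabelianGeometry.EtaleTheta.Discharge.Sec2DtpYThetaAbelianCorollaries
import Literature.AnabelianGeometry.EtaleTheta.Discharge.Sec1DtpYEllZHat
import Literature.AnabelianGeometry.EtaleTheta.Thm16SubdagStatements
import Literature.AnabelianGeometry.EtaleTheta.BarDeltaOfSetting
import Literature.AnabelianGeometry.EtaleTheta.ThetaCyclotomes
import HarnessLib

/-!
# [EtTh] §1 p. 12 «`Δ_Θ (≅ Ẑ(1))`» AS A GALOIS MODULE, part 1: the Tate twist of `Δ_Θ` DERIVED from the Tate twist of
# `(Δ^tp_Y)^ell` through the commutator pairing `∧² Δ^ell_X → Δ_Θ` (proof-only; structure lemmas for the EXISTENCE half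
# of GAP-LEDGER row G-L2t10-1 — the construction of `CyclotomeMod l N` is the sequel `Sec1CyclotomeModOfTate.lean`)

Mochizuki, *The étale theta function and its Frobenioid-theoretic manifestations*, Publ. RIMS **45** (2009) [EtTh],
§1, PRIMS PDF p. 12 (printed 238): «Since `Δ_X` is a profinite free group on 2 generators, we also have a natural exact
sequence `1 → ∧² Δ^ell_X (≅ Ẑ(1)) → Δ^Θ_X → Δ^ell_X → 1` … `(Ẑ(1) ≅) Δ_Θ ⊆ Δ^Θ_X`», p. 13 (printed 239): «a natural exact
sequence of abelian profinite groups `1 → Δ_Θ → (Δ^tp_Y)^Θ → (Δ^tp_Y)^ell → 1`», «`(Δ^tp_Y)^ell ≅ Ẑ(1)`»,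
«`Δ^tp_Y/Δ^tp_{Y_N} ≅ ℤ/Nℤ(1)`» (p. 16) [cite: MochizukiEtTh2009, §1 p.12]; [IUTchII] Rmk. 1.1.1 (iii) «`[-,-] : (Δ_X/Δ_Y) ×
Δ^ell_Y → Δ_Θ`».  Layer L2 of the abc-iut cell, seat abc-iut-w5-d187 (gen 3).  PROOF-ONLY: no definition, no instance, no new
named fact; nothing of another seat's file is edited or restated.

THE GAP.  The root interface `ThetaSetting` (abc-iut-L2-t1, `Setting.lean` v3) defers the transcription «`Δ_Θ ≅ Ẑ(1)` as a
`G_K`-module (the Tate twist)»; the cell carries it as the DATUM `ThetaSetting.CyclotomeMod l N` (abc-iut-L2-t8) / `CyclotomeTower`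
(abc-iut-L2-t10) — GAP-LEDGER row **G-L2t10-1** (group-structure half `Δ_Θ ≃* Ẑ` proved by abc-iut-L2-d1 / w5-d171 / w5-d006,
D-G-w4d021-1; EMPTY at the toy root model, abc-iut-w5-d125).  abc-iut-w5-d051 typed the print-faithful TATE-MODULE CLAUSES of
p. 13 on the `ell`-QUOTIENT as `ThetaSetting.IsTateOrigin`: (a) `(Δ^tp_Y)^ell/N` cyclic of order `N` with generator `ȳ₁`,
(b) the Tate twist `g ȳ g⁻¹ ≡ ȳ^{k}` when `g ζ = ζ^k`, (c) the Kummer class of `q_X`.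

WHAT IS PROVED HERE, for `D : ThetaSetting p`, `z ∈ Δ^tp_X`, `y₁ ∈ Δ^tp_Y`, `c₀ := θ[z, y₁] ∈ Δ_Θ` (`θ : Π^tp_X ↠ (Π^tp_X)^Θ`):
* class-two bilinearity of `(s,t) ↦ [s,t]` on `(Δ^tp_X)^Θ` (`commutator_mul_left/right_dtpTheta`, `…_pow_right…`,
  `…_inv_right…`; commutators lie in the CENTRAL subgroup `Δ_Θ`, root fields `ker_toEll`, `ker_thetaToEll_central` via
  abc-iut's `BarDeltaOfSetting`), unpacking of `N·(Δ^tp_Y)^ell` (`exists_eq_toEll_pow_of_mem_ellPowersY`: every element IS an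
  `N`-th power, `(Δ^tp_Y)^ell` being commutative);
* `exists_toTheta_commutator_eq_pow_mul_pow` — if `ȳ ≡ ȳ₁^k` modulo `N·(Δ^tp_Y)^ell` then `θ[z,y] = e^N · c₀^k`, `e ∈ Δ_Θ`;
* `exists_conj_commutator_eq_pow_mul_pow` — **the Tate twist of `Δ_Θ` from the Tate twist of `(Δ^tp_Y)^ell`**: if conjugation
  by `σ ∈ Π^tp_X` multiplies `ȳ₁` by `k` modulo `N·(Δ^tp_Y)^ell` (clause (b)), then `σ̄ c₀ σ̄⁻¹ = e^N · c₀^k` in `(Π^tp_X)^Θ` with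
  `e ∈ Δ_Θ` — the computation `[σzσ⁻¹, σy₁σ⁻¹] = [v·z, k₁·t^N·y₁^k] = [z,t]^N·[z,y₁]^k` (`v := σzσ⁻¹z⁻¹ ∈ Δ^tp_Y` for EVERY `σ`,
  `(Δ^tp_Y)^Θ` commutative by abc-iut-L2-t8's `dtpYTheta_comm` under the freeness guard, `Δ_Θ` central): the `Z`-direction of
  `∧²(Δ^ell_Y ⊕ Z)` is Galois-trivial modulo `Δ_Y`, so `∧² Δ^ell_X` carries exactly the twist of `Δ^ell_Y`; clause (c) is NOT used;
* `exists_eq_pow_mul_commutator_pow` — `Δ_Θ = c₀^ℕ · Δ_Θ^N` when `ȳ₁` generates `(Δ^tp_Y)^ell/N` (clause (a); Heisenberg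
  surjectivity of `y ↦ θ[z,y]`, abc-iut-L5-t14 / L2-t8, under `IsEtThOrigin` + `hYcl`);
* `dvd_of_commutator_pow_eq_pow` — `c₀` has order EXACTLY `N` modulo `Δ_Θ^N` (non-degeneracy of the pairing, abc-iut-w5-d006
  `toHat_mem_commutatorClosure_of_commutator_mem`, + clause (a)'s «`ȳ₁^k ∈ N·(Δ^tp_Y)^ell ↔ N ∣ k`»);
* `galMuN_eq_pow_of_apply_eq_pow`, `exists_apply_eq_pow` — the Galois action on `μ_N ⊆ ℚ̄_p` read off a primitive root.
HONEST FRAMING: [EtTh] is refereed; the theta setting is data quoting print, not asserted to exist; OUR kernel check that the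
printed Galois-module structure of `Δ_Θ` follows from that of `(Δ^tp_Y)^ell`; no side taken on [IUTchIII] Cor. 3.12.
-/

noncomputable section

namespace Literature.AnabelianGeometry.EtaleTheta

open Literature.AnabelianGeometry.SemiGraphs
open _root_.Topology

namespace ThetaSetting

variable {p : ℕ} [Fact p.Prime] (D : ThetaSetting p)

/-! ### Class-two bilinearity of the commutator pairing in `(Δ^tp_X)^Θ` -/

/-- `[s, t·u] = [s,t]·[s,u]` for `s, t, u ∈ (Δ^tp_X)^Θ` (commutators are central: `Δ^Θ_X` is a central
extension of `Δ^ell_X` by `Δ_Θ`, p. 12). [cite: MochizukiEtTh2009, §1 p.12] -/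
theorem commutator_mul_right_dtpTheta {s t u : D.GtpTheta} (hs : s ∈ D.DtpTheta) (ht : t ∈ D.DtpTheta)
    (hu : u ∈ D.DtpTheta) :
    s * (t * u) * s⁻¹ * (t * u)⁻¹ = (s * t * s⁻¹ * t⁻¹) * (s * u * s⁻¹ * u⁻¹) := by
  have hcu : s * u * s⁻¹ * u⁻¹ ∈ D.DeltaTheta := D.commutator_mem_deltaTheta hs hu
  have hc : (s * u * s⁻¹ * u⁻¹) * t = t * (s * u * s⁻¹ * u⁻¹) := D.deltaTheta_comm_dtpTheta hcu ht
  calc s * (t * u) * s⁻¹ * (t * u)⁻¹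
      = (s * t * s⁻¹ * t⁻¹) * (t * ((s * u * s⁻¹ * u⁻¹) * t⁻¹)) := by group
    _ = (s * t * s⁻¹ * t⁻¹) * (t * (t⁻¹ * (s * u * s⁻¹ * u⁻¹))) := by
        rw [show (s * u * s⁻¹ * u⁻¹) * t⁻¹ = t⁻¹ * (s * u * s⁻¹ * u⁻¹) from by
          rw [eq_inv_mul_iff_mul_eq, ← mul_assoc, ← hc, mul_assoc, mul_inv_cancel, mul_one]]
    _ = (s * t * s⁻¹ * t⁻¹) * (s * u * s⁻¹ * u⁻¹) := by group

/-- `[s·t, u] = [s,u]·[t,u]` for `s, t, u ∈ (Δ^tp_X)^Θ`. [cite: MochizukiEtTh2009, §1 p.12] -/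
theorem commutator_mul_left_dtpTheta {s t u : D.GtpTheta} (hs : s ∈ D.DtpTheta) (ht : t ∈ D.DtpTheta)
    (hu : u ∈ D.DtpTheta) :
    (s * t) * u * (s * t)⁻¹ * u⁻¹ = (s * u * s⁻¹ * u⁻¹) * (t * u * t⁻¹ * u⁻¹) := by
  have hct : t * u * t⁻¹ * u⁻¹ ∈ D.DeltaTheta := D.commutator_mem_deltaTheta ht hu
  have hcs : s * u * s⁻¹ * u⁻¹ ∈ D.DeltaTheta := D.commutator_mem_deltaTheta hs hu
  -- `[st,u] = s [t,u] s⁻¹ · [s,u]`, and `[t,u]` is central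
  have h1 : (s * t) * u * (s * t)⁻¹ * u⁻¹ = s * (t * u * t⁻¹ * u⁻¹) * s⁻¹ * (s * u * s⁻¹ * u⁻¹) := by group
  have h2 : s * (t * u * t⁻¹ * u⁻¹) * s⁻¹ = t * u * t⁻¹ * u⁻¹ := by
    rw [← D.deltaTheta_comm_dtpTheta hct hs, mul_assoc, mul_inv_cancel, mul_one]
  rw [h1, h2]
  exact D.ker_thetaToEll_comm _ hct _ hcs

/-- `[s, t^n] = [s,t]^n` for `s, t ∈ (Δ^tp_X)^Θ`. [cite: MochizukiEtTh2009, §1 p.12] -/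
theorem commutator_pow_right_dtpTheta {s t : D.GtpTheta} (hs : s ∈ D.DtpTheta) (ht : t ∈ D.DtpTheta)
    (n : ℕ) : s * t ^ n * s⁻¹ * (t ^ n)⁻¹ = (s * t * s⁻¹ * t⁻¹) ^ n := by
  induction n with
  | zero => simp
  | succ n ih =>
    rw [pow_succ, D.commutator_mul_right_dtpTheta hs (Subgroup.pow_mem _ ht n) ht, ih, ← pow_succ]

/-- `[s, t⁻¹] = [s,t]⁻¹` for `s, t ∈ (Δ^tp_X)^Θ`. [cite: MochizukiEtTh2009, §1 p.12] -/
theorem commutator_inv_right_dtpTheta {s t : D.GtpTheta} (hs : s ∈ D.DtpTheta) (ht : t ∈ D.DtpTheta) :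
    s * t⁻¹ * s⁻¹ * t⁻¹⁻¹ = (s * t * s⁻¹ * t⁻¹)⁻¹ := by
  have h := D.commutator_mul_right_dtpTheta hs ht (Subgroup.inv_mem _ ht)
  have h1 : s * (t * t⁻¹) * s⁻¹ * (t * t⁻¹)⁻¹ = 1 := by group
  rw [h1] at h
  exact eq_inv_of_mul_eq_one_right h.symm

/-- A central element has trivial commutators: `[s, e] = 1` for `e ∈ Δ_Θ`, `s ∈ (Δ^tp_X)^Θ`.
[cite: MochizukiEtTh2009, §1 p.12] -/
theorem commutator_eq_one_of_mem_deltaTheta {s e : D.GtpTheta} (hs : s ∈ D.DtpTheta)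
    (he : e ∈ D.DeltaTheta) : s * e * s⁻¹ * e⁻¹ = 1 := by
  have h : s * e = e * s := (D.deltaTheta_comm_dtpTheta he hs).symm
  rw [h]
  group

/-- Commutators of two elements of `(Δ^tp_Y)^Θ` vanish (abc-iut-L2-t8's `dtpYTheta_comm`: `(Δ^tp_Y)^Θ` is
commutative under the freeness guard). [cite: MochizukiEtTh2009, §1 p.12] -/
theorem commutator_eq_one_of_mem_dtpYTheta (hO : D.IsEtThOrigin) {s t : D.GtpTheta}
    (hs : s ∈ D.DtpYTheta) (ht : t ∈ D.DtpYTheta) : s * t * s⁻¹ * t⁻¹ = 1 := by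
  rw [D.dtpYTheta_comm hO s hs t ht]
  group

/-! ### `(Δ^tp_X)^ell` is commutative on `Δ^tp_X`; unpacking `N·(Δ^tp_Y)^ell` -/

/-- The images in `(Π^tp_X)^ell` of two elements of `Δ^tp_X` commute (`Δ^ell_X = Δ^ab_X`, p. 12).
[cite: MochizukiEtTh2009, §1 p.12] -/
theorem toEll_comm_of_mem_deltaTemp {x y : D.PiTemp} (hx : x ∈ D.DeltaTemp) (hy : y ∈ D.DeltaTemp) :
    Thm16Sub.toEll D x * Thm16Sub.toEll D y = Thm16Sub.toEll D y * Thm16Sub.toEll D x := by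
  have h : D.toTheta x * D.toTheta y * (D.toTheta x)⁻¹ * (D.toTheta y)⁻¹ ∈ D.DeltaTheta :=
    D.commutator_mem_deltaTheta (Subgroup.mem_map_of_mem _ hx) (Subgroup.mem_map_of_mem _ hy)
  have h1 : D.thetaToEll (D.toTheta x * D.toTheta y * (D.toTheta x)⁻¹ * (D.toTheta y)⁻¹) = 1 := h
  rw [map_mul, map_mul, map_mul, map_inv, map_inv, ← commutatorElement_def,
    commutatorElement_eq_one_iff_mul_comm] at h1
  exact h1

/-- Every element of `N·(Δ^tp_Y)^ell` (the subgroup generated by the `N`-th powers of `(Δ^tp_Y)^ell`) IS an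
`N`-th power `ȳ^N`, `y ∈ Δ^tp_Y` (`(Δ^tp_Y)^ell` is commutative). [cite: MochizukiEtTh2009, §1 p.13] -/
theorem exists_eq_toEll_pow_of_mem_ellPowersY {N : ℕ+} {x : D.GtpEll}
    (hx : x ∈ Thm16Sub.ellPowersY D N) :
    ∃ t ∈ D.DtpY, x = Thm16Sub.toEll D t ^ (N : ℕ) := by
  unfold Thm16Sub.ellPowersY at hx
  induction hx using Subgroup.closure_induction with
  | mem v hv =>
    obtain ⟨w, ⟨t, ht, rfl⟩, rfl⟩ := hv
    exact ⟨t, ht, rfl⟩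
  | one => exact ⟨1, one_mem _, by rw [map_one, one_pow]⟩
  | mul a b _ _ iha ihb =>
    obtain ⟨t, ht, rfl⟩ := iha
    obtain ⟨t', ht', rfl⟩ := ihb
    refine ⟨t * t', mul_mem ht ht', ?_⟩
    rw [map_mul, (Commute.mul_pow (D.toEll_comm_of_mem_deltaTemp ht.2 ht'.2)) (N : ℕ)]
  | inv a _ iha =>
    obtain ⟨t, ht, rfl⟩ := iha
    exact ⟨t⁻¹, inv_mem ht, by rw [map_inv, inv_pow]⟩

/-- Unpacking a congruence modulo `N·(Δ^tp_Y)^ell`: an element `u ∈ Δ^tp_Y` whose image lies in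
`N·(Δ^tp_Y)^ell` is `k₁ · t^N` with `t ∈ Δ^tp_Y` and `k₁ ∈ Δ^tp_Y ∩ Ker(Π^tp_X ↠ (Π^tp_X)^ell)`.
[cite: MochizukiEtTh2009, §1 p.13] -/
theorem exists_eq_mul_pow_of_toEll_mem_ellPowersY {N : ℕ+} {u : D.PiTemp} (hu : u ∈ D.DtpY)
    (h : Thm16Sub.toEll D u ∈ Thm16Sub.ellPowersY D N) :
    ∃ k₁ ∈ D.DtpY, ∃ t ∈ D.DtpY, Thm16Sub.toEll D k₁ = 1 ∧ u = k₁ * t ^ (N : ℕ) := by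
  obtain ⟨t, ht, hut⟩ := D.exists_eq_toEll_pow_of_mem_ellPowersY h
  refine ⟨u * (t ^ (N : ℕ))⁻¹, mul_mem hu (inv_mem (pow_mem ht _)), t, ht, ?_, ?_⟩
  · rw [map_mul, map_inv, map_pow, hut, mul_inv_cancel]
  · rw [inv_mul_cancel_right]

/-! ### The commutator pairing `y ↦ θ[z, y]` and the Tate twist of `Δ_Θ` -/

/-- `θ[z, y] ∈ Δ_Θ` for `z, y ∈ Δ^tp_X`. [cite: MochizukiEtTh2009, §1 p.12] -/
theorem toTheta_commutator_mem_deltaTheta {z y : D.PiTemp} (hz : z ∈ D.DeltaTemp) (hy : y ∈ D.DeltaTemp) :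
    D.toTheta (z * y * z⁻¹ * y⁻¹) ∈ D.DeltaTheta := by
  simpa only [map_mul, map_inv] using
    D.commutator_mem_deltaTheta (Subgroup.mem_map_of_mem _ hz) (Subgroup.mem_map_of_mem _ hy)

/-- `θ[z, y·y'] = θ[z,y]·θ[z,y']` for `z, y, y' ∈ Δ^tp_X` (bilinearity of the commutator map of
[IUTchII] Rmk. 1.1.1 (iii), `(Δ_X/Δ_Y) × Δ^ell_Y → Δ_Θ`). [cite: MochizukiEtTh2009, §1 p.12] -/
theorem toTheta_commutator_mul {z y y' : D.PiTemp} (hz : z ∈ D.DeltaTemp) (hy : y ∈ D.DeltaTemp)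
    (hy' : y' ∈ D.DeltaTemp) :
    D.toTheta (z * (y * y') * z⁻¹ * (y * y')⁻¹) =
      D.toTheta (z * y * z⁻¹ * y⁻¹) * D.toTheta (z * y' * z⁻¹ * y'⁻¹) := by
  simp only [map_mul, map_inv]
  exact D.commutator_mul_right_dtpTheta (Subgroup.mem_map_of_mem _ hz) (Subgroup.mem_map_of_mem _ hy)
    (Subgroup.mem_map_of_mem _ hy')

/-- `θ[z, y^n] = θ[z,y]^n`. [cite: MochizukiEtTh2009, §1 p.12] -/
theorem toTheta_commutator_pow {z y : D.PiTemp} (hz : z ∈ D.DeltaTemp) (hy : y ∈ D.DeltaTemp) (n : ℕ) :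
    D.toTheta (z * y ^ n * z⁻¹ * (y ^ n)⁻¹) = D.toTheta (z * y * z⁻¹ * y⁻¹) ^ n := by
  simp only [map_mul, map_inv, map_pow]
  exact D.commutator_pow_right_dtpTheta (Subgroup.mem_map_of_mem _ hz) (Subgroup.mem_map_of_mem _ hy) n

/-- `θ[z, k] = 1` when `k ∈ Δ^tp_X` dies in `(Π^tp_X)^ell` (its image `θ k ∈ Δ_Θ` is central).
[cite: MochizukiEtTh2009, §1 p.12] -/
theorem toTheta_commutator_eq_one_of_toEll_eq_one {z k : D.PiTemp} (hz : z ∈ D.DeltaTemp)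
    (hk : Thm16Sub.toEll D k = 1) : D.toTheta (z * k * z⁻¹ * k⁻¹) = 1 := by
  simp only [map_mul, map_inv]
  exact D.commutator_eq_one_of_mem_deltaTheta (Subgroup.mem_map_of_mem _ hz) hk

/-- **The pairing modulo `N`**: if `y ∈ Δ^tp_Y` is congruent to `y₁^k` modulo `N·(Δ^tp_Y)^ell` (clause (a) of the
Tate-module datum), then `θ[z, y] = e^N · θ[z, y₁]^k` for some `e ∈ Δ_Θ`. [cite: MochizukiEtTh2009, §1 p.13] -/
theorem exists_toTheta_commutator_eq_pow_mul_pow {N : ℕ+} {z y₁ y : D.PiTemp} (hz : z ∈ D.DeltaTemp)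
    (hy₁ : y₁ ∈ D.DtpY) (hy : y ∈ D.DtpY) {k : ℕ}
    (hk : Thm16Sub.toEll D y * (Thm16Sub.toEll D y₁ ^ k)⁻¹ ∈ Thm16Sub.ellPowersY D N) :
    ∃ e ∈ D.DeltaTheta, D.toTheta (z * y * z⁻¹ * y⁻¹) =
      e ^ (N : ℕ) * D.toTheta (z * y₁ * z⁻¹ * y₁⁻¹) ^ k := by
  have hu : y * (y₁ ^ k)⁻¹ ∈ D.DtpY := mul_mem hy (inv_mem (pow_mem hy₁ k))
  have hu' : Thm16Sub.toEll D (y * (y₁ ^ k)⁻¹) ∈ Thm16Sub.ellPowersY D N := by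
    rw [map_mul, map_inv, map_pow]; exact hk
  obtain ⟨k₁, hk₁, t, ht, hk₁1, hut⟩ := D.exists_eq_mul_pow_of_toEll_mem_ellPowersY hu hu'
  -- `y = k₁ · t^N · y₁^k`
  have hy_eq : y = k₁ * t ^ (N : ℕ) * y₁ ^ k := by
    rw [← hut, inv_mul_cancel_right]
  refine ⟨D.toTheta (z * t * z⁻¹ * t⁻¹), D.toTheta_commutator_mem_deltaTheta hz ht.2, ?_⟩
  rw [hy_eq, D.toTheta_commutator_mul hz (mul_mem hk₁.2 (pow_mem ht.2 _)) (pow_mem hy₁.2 _),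
    D.toTheta_commutator_mul hz hk₁.2 (pow_mem ht.2 _), D.toTheta_commutator_eq_one_of_toEll_eq_one hz hk₁1,
    one_mul, D.toTheta_commutator_pow hz ht.2, D.toTheta_commutator_pow hz hy₁.2]

/-- `σ z σ⁻¹ z⁻¹ ∈ Δ^tp_Y` for `z ∈ Δ^tp_X` and ANY `σ ∈ Π^tp_X` (`Z` and `G_K` are commutative quotients of
`Π^tp_X` through `toZ` and `aug`). [cite: MochizukiEtTh2009, §1 p.12] -/
theorem conj_mul_inv_mem_dtpY {z : D.PiTemp} (hz : z ∈ D.DeltaTemp) (σ : D.PiTemp) :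
    σ * z * σ⁻¹ * z⁻¹ ∈ D.DtpY := by
  refine ⟨?_, ?_⟩
  · change σ * z * σ⁻¹ * z⁻¹ ∈ D.toZ.ker
    rw [MonoidHom.mem_ker, map_mul, map_mul, map_mul, map_inv, map_inv, mul_comm (D.toZ σ) (D.toZ z),
      mul_inv_cancel_right, mul_inv_cancel]
  · have hz1 : D.aug.toMonoidHom z = 1 := hz
    change σ * z * σ⁻¹ * z⁻¹ ∈ D.aug.toMonoidHom.ker
    rw [MonoidHom.mem_ker, map_mul, map_mul, map_mul, map_inv, map_inv, hz1, mul_one, inv_one, mul_one,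
      mul_inv_cancel]

/-- **The Tate twist of `Δ_Θ` from the Tate twist of `(Δ^tp_Y)^ell`** («`Δ_Θ (≅ Ẑ(1))`», the image of
`∧² Δ^ell_X`, p. 12): let `z ∈ Δ^tp_X`, `y₁ ∈ Δ^tp_Y`, `c₀ := θ[z, y₁] ∈ Δ_Θ`; if conjugation by `σ ∈ Π^tp_X`
multiplies `ȳ₁ ∈ (Δ^tp_Y)^ell` by `k` modulo `N·(Δ^tp_Y)^ell` (clause (b) of the Tate-module datum at the
character value `k = χ_N(σ)`), then `σ̄ c₀ σ̄⁻¹ = e^N · c₀^k` in `(Π^tp_X)^Θ` for some `e ∈ Δ_Θ` — the class-two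
computation `[σzσ⁻¹, σy₁σ⁻¹] = [v·z, k₁ t^N y₁^k] = [z,t]^N [z,y₁]^k` (`v = σzσ⁻¹z⁻¹ ∈ Δ^tp_Y`, `(Δ^tp_Y)^Θ`
commutative, `Δ_Θ` central). [cite: MochizukiEtTh2009, §1 p.12] -/
theorem exists_conj_commutator_eq_pow_mul_pow (hO : D.IsEtThOrigin) {N : ℕ+} {z y₁ : D.PiTemp}
    (hz : z ∈ D.DeltaTemp) (hy₁ : y₁ ∈ D.DtpY) (σ : D.PiTemp) {k : ℕ}
    (htw : Thm16Sub.toEll D (σ * y₁ * σ⁻¹) * (Thm16Sub.toEll D y₁ ^ k)⁻¹ ∈ Thm16Sub.ellPowersY D N) :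
    ∃ e ∈ D.DeltaTheta, D.toTheta σ * D.toTheta (z * y₁ * z⁻¹ * y₁⁻¹) * (D.toTheta σ)⁻¹ =
      e ^ (N : ℕ) * D.toTheta (z * y₁ * z⁻¹ * y₁⁻¹) ^ k := by
  haveI : D.GtpY.Normal := inferInstanceAs D.toZ.ker.Normal
  haveI : D.DeltaTemp.Normal := inferInstanceAs D.aug.toMonoidHom.ker.Normal
  haveI : D.DtpY.Normal := Subgroup.normal_inf_normal _ _
  -- `σ y₁ σ⁻¹ = k₁ · t₁^N · y₁^k`
  have hy' : σ * y₁ * σ⁻¹ ∈ D.DtpY := (inferInstance : D.DtpY.Normal).conj_mem y₁ hy₁ σ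
  have hu : σ * y₁ * σ⁻¹ * (y₁ ^ k)⁻¹ ∈ D.DtpY := mul_mem hy' (inv_mem (pow_mem hy₁ k))
  have hu' : Thm16Sub.toEll D (σ * y₁ * σ⁻¹ * (y₁ ^ k)⁻¹) ∈ Thm16Sub.ellPowersY D N := by
    rw [map_mul (Thm16Sub.toEll D) (σ * y₁ * σ⁻¹), map_inv, map_pow]; exact htw
  obtain ⟨k₁, hk₁, t₁, ht₁, hk₁1, hut⟩ := D.exists_eq_mul_pow_of_toEll_mem_ellPowersY hu hu'
  have hy'_eq : σ * y₁ * σ⁻¹ = k₁ * t₁ ^ (N : ℕ) * y₁ ^ k := by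
    rw [← hut, inv_mul_cancel_right]
  -- `σ z σ⁻¹ = v · z`, `v ∈ Δ^tp_Y`
  have hv : σ * z * σ⁻¹ * z⁻¹ ∈ D.DtpY := D.conj_mul_inv_mem_dtpY hz σ
  have hz' : σ * z * σ⁻¹ = (σ * z * σ⁻¹ * z⁻¹) * z := by rw [inv_mul_cancel_right]
  -- conjugating the commutator
  have hconj : D.toTheta σ * D.toTheta (z * y₁ * z⁻¹ * y₁⁻¹) * (D.toTheta σ)⁻¹ =
      D.toTheta ((σ * z * σ⁻¹) * (σ * y₁ * σ⁻¹) * (σ * z * σ⁻¹)⁻¹ * (σ * y₁ * σ⁻¹)⁻¹) := by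
    simp only [map_mul, map_inv]; group
  refine ⟨D.toTheta (z * t₁ * z⁻¹ * t₁⁻¹), D.toTheta_commutator_mem_deltaTheta hz ht₁.2, ?_⟩
  rw [hconj, hz']
  -- `[v·z, y'] = [v, y'] · [z, y']` and `[v, y'] = 1`
  have hsplit : D.toTheta ((σ * z * σ⁻¹ * z⁻¹) * z * (σ * y₁ * σ⁻¹) * ((σ * z * σ⁻¹ * z⁻¹) * z)⁻¹ *
        (σ * y₁ * σ⁻¹)⁻¹) =
      D.toTheta ((σ * z * σ⁻¹ * z⁻¹) * (σ * y₁ * σ⁻¹) * (σ * z * σ⁻¹ * z⁻¹)⁻¹ * (σ * y₁ * σ⁻¹)⁻¹) *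
        D.toTheta (z * (σ * y₁ * σ⁻¹) * z⁻¹ * (σ * y₁ * σ⁻¹)⁻¹) := by
    have h1 : D.toTheta (σ * z * σ⁻¹ * z⁻¹) ∈ D.DtpTheta := Subgroup.mem_map_of_mem _ hv.2
    have h3 : D.toTheta (σ * y₁ * σ⁻¹) ∈ D.DtpTheta := Subgroup.mem_map_of_mem _ hy'.2
    simp only [map_mul, map_inv] at h1 h3 ⊢
    exact D.commutator_mul_left_dtpTheta h1 (Subgroup.mem_map_of_mem _ hz) h3
  have hvy : D.toTheta ((σ * z * σ⁻¹ * z⁻¹) * (σ * y₁ * σ⁻¹) * (σ * z * σ⁻¹ * z⁻¹)⁻¹ * (σ * y₁ * σ⁻¹)⁻¹) = 1 := by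
    have h1 : D.toTheta (σ * z * σ⁻¹ * z⁻¹) ∈ D.DtpYTheta := Subgroup.mem_map_of_mem _ hv
    have h3 : D.toTheta (σ * y₁ * σ⁻¹) ∈ D.DtpYTheta := Subgroup.mem_map_of_mem _ hy'
    simp only [map_mul, map_inv] at h1 h3 ⊢
    exact D.commutator_eq_one_of_mem_dtpYTheta hO h1 h3
  rw [hsplit, hvy, one_mul, hy'_eq,
    D.toTheta_commutator_mul hz (mul_mem hk₁.2 (pow_mem ht₁.2 _)) (pow_mem hy₁.2 _),
    D.toTheta_commutator_mul hz hk₁.2 (pow_mem ht₁.2 _), D.toTheta_commutator_eq_one_of_toEll_eq_one hz hk₁1,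
    one_mul, D.toTheta_commutator_pow hz ht₁.2, D.toTheta_commutator_pow hz hy₁.2]

/-- `θ[z, y⁻¹] = θ[z,y]⁻¹`. [cite: MochizukiEtTh2009, §1 p.12] -/
theorem toTheta_commutator_inv {z y : D.PiTemp} (hz : z ∈ D.DeltaTemp) (hy : y ∈ D.DeltaTemp) :
    D.toTheta (z * y⁻¹ * z⁻¹ * y⁻¹⁻¹) = (D.toTheta (z * y * z⁻¹ * y⁻¹))⁻¹ := by
  simp only [map_mul, map_inv]
  exact D.commutator_inv_right_dtpTheta (Subgroup.mem_map_of_mem _ hz) (Subgroup.mem_map_of_mem _ hy)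

/-! ### The structure of `Δ_Θ` modulo `N` from the Tate-module clauses -/

/-- **`Δ_Θ = c₀^ℕ · Δ_Θ^N`**: if `y₁` generates `(Δ^tp_Y)^ell` modulo `N·(Δ^tp_Y)^ell` (clause (a) of the Tate-module
datum) then every element of `Δ_Θ` is `e^N · c₀^k`, `c₀ := θ[z, y₁]`, for the generator `z` of `Z` — Heisenberg
surjectivity of the pairing (abc-iut-L5-t14/L2-t8, under `IsEtThOrigin` and `hYcl`) and bilinearity.
[cite: MochizukiEtTh2009, §1 p.12] -/
theorem exists_eq_pow_mul_commutator_pow (hO : D.IsEtThOrigin)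
    (hYcl : (D.DtpY.map D.toHat.toMonoidHom).topologicalClosure ≤
      D.DtpY.map D.toHat.toMonoidHom ⊔ (⁅⁅D.DeltaHat, D.DeltaHat⁆, D.DeltaHat⁆).topologicalClosure)
    {N : ℕ+} {z y₁ : D.PiTemp} (hz : z ∈ D.DeltaTemp) (hzZ : D.toZ z = Multiplicative.ofAdd 1)
    (hy₁ : y₁ ∈ D.DtpY)
    (hgen : ∀ y ∈ D.DtpY, ∃ k : ℕ,
      Thm16Sub.toEll D y * (Thm16Sub.toEll D y₁ ^ k)⁻¹ ∈ Thm16Sub.ellPowersY D N)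
    {s : D.GtpTheta} (hs : s ∈ D.DeltaTheta) :
    ∃ e ∈ D.DeltaTheta, ∃ k : ℕ, s = e ^ (N : ℕ) * D.toTheta (z * y₁ * z⁻¹ * y₁⁻¹) ^ k := by
  obtain ⟨y, hy, hys⟩ := D.exists_commutator_of_mem_deltaTheta_of_origin hO hYcl hz hzZ hs
  obtain ⟨k, hk⟩ := hgen y hy
  obtain ⟨e, he, heq⟩ := D.exists_toTheta_commutator_eq_pow_mul_pow hz hy₁ hy hk
  exact ⟨e, he, k, by rw [← hys, heq]⟩

/-- **`c₀` has order exactly `N` modulo `Δ_Θ^N`**: if `c₀^d` is an `N`-th power in `Δ_Θ` then `N ∣ d` — by the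
NON-DEGENERACY of the pairing (abc-iut-w5-d006: `[ι z, ι u] ∈ [[Δ_X,Δ_X],Δ_X]⁻` forces `ι u ∈ [Δ_X,Δ_X]⁻`) and clause
(a)'s «`ȳ₁^k ∈ N·(Δ^tp_Y)^ell ↔ N ∣ k`». [cite: MochizukiEtTh2009, §1 p.13] -/
theorem dvd_of_commutator_pow_eq_pow (hO : D.IsEtThOrigin)
    (hYcl : (D.DtpY.map D.toHat.toMonoidHom).topologicalClosure ≤
      D.DtpY.map D.toHat.toMonoidHom ⊔ (⁅⁅D.DeltaHat, D.DeltaHat⁆, D.DeltaHat⁆).topologicalClosure)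
    {N : ℕ+} {z y₁ : D.PiTemp} (hz : z ∈ D.DeltaTemp) (hzZ : D.toZ z = Multiplicative.ofAdd 1)
    (hy₁ : y₁ ∈ D.DtpY)
    (hord : ∀ k : ℕ, Thm16Sub.toEll D y₁ ^ k ∈ Thm16Sub.ellPowersY D N ↔ (N : ℕ) ∣ k)
    {d : ℕ} {e : D.GtpTheta} (he : e ∈ D.DeltaTheta)
    (h : D.toTheta (z * y₁ * z⁻¹ * y₁⁻¹) ^ d = e ^ (N : ℕ)) : (N : ℕ) ∣ d := by
  -- `e = θ[z, y']`
  obtain ⟨y', hy', hye⟩ := D.exists_commutator_of_mem_deltaTheta_of_origin hO hYcl hz hzZ he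
  -- `u := y₁^d · (y'^N)⁻¹` pairs trivially with `z`
  have hu : y₁ ^ d * (y' ^ (N : ℕ))⁻¹ ∈ D.DtpY := mul_mem (pow_mem hy₁ d) (inv_mem (pow_mem hy' _))
  have hpair : D.toTheta (z * (y₁ ^ d * (y' ^ (N : ℕ))⁻¹) * z⁻¹ * (y₁ ^ d * (y' ^ (N : ℕ))⁻¹)⁻¹) = 1 := by
    rw [D.toTheta_commutator_mul hz (pow_mem hy₁.2 d) (inv_mem (pow_mem hy'.2 _)),
      D.toTheta_commutator_pow hz hy₁.2, D.toTheta_commutator_inv hz (pow_mem hy'.2 _),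
      D.toTheta_commutator_pow hz hy'.2, hye, h, mul_inv_cancel]
  -- hence `[ι z, ι u] ∈ K₃`, so `ι u ∈ K₂`, i.e. `u` dies in `(Π^tp_X)^ell`
  have hker : z * (y₁ ^ d * (y' ^ (N : ℕ))⁻¹) * z⁻¹ * (y₁ ^ d * (y' ^ (N : ℕ))⁻¹)⁻¹ ∈ D.toTheta.ker := hpair
  rw [D.ker_toTheta, Subgroup.mem_comap, map_mul, map_mul, map_mul, map_inv, map_inv,
    ← commutatorElement_def] at hker
  have hK₂ := IsEtThOrigin.toHat_mem_commutatorClosure_of_commutator_mem D hO hz hzZ hu hker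
  have hEll : Thm16Sub.toEll D (y₁ ^ d * (y' ^ (N : ℕ))⁻¹) = 1 := by
    have : y₁ ^ d * (y' ^ (N : ℕ))⁻¹ ∈ (D.thetaToEll.comp D.toTheta).ker := by
      rw [D.ker_toEll, Subgroup.mem_comap]; exact hK₂
    exact this
  rw [map_mul, map_inv, map_pow, map_pow, mul_inv_eq_one] at hEll
  refine (hord d).mp ?_
  rw [hEll]
  exact Subgroup.subset_closure ⟨Thm16Sub.toEll D y', ⟨y', hy', rfl⟩, rfl⟩

/-- The Galois action on `μ_N` read off a primitive root: if `g ζ = ζ^k` for a primitive `N`-th root of unity `ζ`,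
then `g` acts on all of `μ_N` as `ξ ↦ ξ^k`. [cite: MochizukiEtTh2009, Def 2.10 p.44] -/
theorem galMuN_eq_pow_of_apply_eq_pow {N : ℕ+} {ζ : PadicAlgCl p} (hζ : IsPrimitiveRoot ζ (N : ℕ))
    {g : GQp p} {k : ℕ} (hg : g ζ = ζ ^ k) (ξ : MuN p N) : galMuN p N g ξ = ξ ^ k := by
  have hξN : (((ξ : (PadicAlgCl p)ˣ) : PadicAlgCl p)) ^ (N : ℕ) = 1 := by
    have h := ξ.2
    rw [mem_rootsOfUnity] at h
    have := congrArg (fun u : (PadicAlgCl p)ˣ => (u : PadicAlgCl p)) h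
    simpa using this
  obtain ⟨i, -, hi⟩ := hζ.eq_pow_of_pow_eq_one hξN
  apply Subtype.ext
  apply Units.ext
  rw [galMuN_apply_coe, ← hi, map_pow, hg, ← pow_mul, mul_comm, pow_mul]
  push_cast
  rw [← hi]

/-- For every `g ∈ G_{ℚ_p}` there is an exponent `k` with `g ζ = ζ^k` (`g ζ` is again an `N`-th root of unity).
[cite: MochizukiEtTh2009, Def 2.10 p.44] -/
theorem exists_apply_eq_pow {N : ℕ+} {ζ : PadicAlgCl p} (hζ : IsPrimitiveRoot ζ (N : ℕ)) (g : GQp p) :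
    ∃ k : ℕ, g ζ = ζ ^ k := by
  have h : (g ζ) ^ (N : ℕ) = 1 := by rw [← map_pow, hζ.pow_eq_one, map_one]
  obtain ⟨i, -, hi⟩ := hζ.eq_pow_of_pow_eq_one h
  exact ⟨i, hi.symm⟩

end ThetaSetting

end Literature.AnabelianGeometry.EtaleTheta

end
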